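import Summits.BirchSwinnertonDyer.BirchSwinnertonDyer.Theorems.ClassRecordThreeCornerTwinHalvesDefs
import Literature.NumberTheory.EllipticCurves.ComplexMultiplicationShaRubinHomDescentProofs
import Literature.NumberTheory.EllipticCurves.AnalyticRankOrderProofs
import Literature.NumberTheory.EllipticCurves.LeadingTerm
import Mathlib.GroupTheory.Perm.Cycle.Type
import HarnessLib

/-!
# Crux `CornerAtThreeW` (item stmt-BirchSwinnertonDyer-21420), idea card M
# «elliptic-unit reflex twin descent at 3» — typed companion (planner sketch, NOT a Theorems file)

Seat `bsd-stepL-mult-idea` g10 (ideation planner; no claim). Scope: the UPPER half F2′ = `CornerTwinUpperAt W`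
(`Theorems/ClassRecordThreeCornerTwinHalvesDefs.lean`, card J) of the (W) conjunct of `CornerAtThreeW`.

THE LEVER (informal; the class-group side is not typable in the tree today): on the corner the image of
`ρ̄_{E^d,3}` is the full normaliser `N(C)` of a Cartan subgroup, a group of order `8` or `16` PRIME TO `3`.
Hence (i) inflation–restriction is exact (`§2`, Sah's lemma with the CENTRAL element `-I ∈ N(C)`), so
`Sel₃(E^d/ℚ)` is the `V`-isotypic part (`V = E^d[3]`) of an explicit subquotient of
`{units, 3-units, 3-class group}` of the `3`-division field `L_d = ℚ(E^d[3])`, cut by the `μ₃`-line condition at `3`;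
(ii) `L_d` is ABELIAN (Klein or `C₈`) over the imaginary one `M` of the two quadratic fields `F, F'` inside
`ℚ(E[3])`, with `3 ∤ w_M·[L_d:M]`, so Rubin's elliptic-unit Euler system (Invent. 103 (1991), hypothesis
`p ∤ w_K[F:K]`) bounds the `V`-part of `Cl(L_d)[3^∞]` by the `3`-index of ONE elliptic unit `u_d`.
So `Sel₃(E^d) = 0` — hence F2′ at an exact twin — follows from a GL₁ statement over `M` plus a finite `3`-adic test.

What IS typed and kernel-checked here (sorry-free):
* `§1` the interface to the route: `Sel₃(Wd) = ⊥ ∧ Ш(Wd) finite ⟹ 3 ∤ #Ш(Wd)` (Cauchy + the tree's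
  `sha_torsionBy_eq_zero_of_selmerGroup_eq_bot`), and `CornerReflexTrivialTwinAt W → CornerTwinUpperAt W` BY NAME;
  the finiteness is discharged from the frame's `L(E^d,1) ≠ 0` by the Gross–Zagier–Kolyvagin fact
  (`CornerSelmerTrivialTwinAt W → CornerReflexTrivialTwinAt W` under `hasEntireLFunction_rat` and
  `rank_eq_analyticRank_of_analyticRank_le_one`).
* `§2` the exactness of the descent on the corner: `ker(H¹(ℚ,E^d[3]) → H¹(ℚ(E^d[3]),E^d[3])) = 0` from a central
  element acting as `-1` (the tree's Sah lemma `Rubin1987.subgroupResKer_eq_bot_of_bijOn`).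
* `§3` the OPEN supply statement of the line, `CornerEllipticUnitReflexSupplyAt W` (an `∃`-twin statement at the
  OUTPUT level `Sel₃ = ⊥`; its class-field-theoretic sufficient condition (R1)+(R2) is in the docstring), and the
  class-wide bookkeeping `cornerTwinUpper_of_supply`.

HONEST FRAMING: nothing here proves BSD₃ of any curve; `CornerTwinUpperAt` stays `@[conjecture]`; the class-wide
supply is conjecture-grade (a per-pair CERTIFICATE: relative class number of a quartic ∕ degree-16 field + one unit,
PARI-computable — unlike a `3`-descent, which PARI does not offer).
References: K. Rubin, Invent. Math. 103 (1991) 25–68 (Thm. on `#A(F)^χ ∣ #(𝓔/𝓒)(F)^χ`, `p ∤ w_K[F:K]`);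
K. Česnavičius, Compos. Math. 151 (2015) 416–434, §3 (up-bds) [arXiv:1307.4261 p. 6];
E. Schaefer – M. Stoll, Trans. AMS 356 (2004) (descent via `p`-division field);
S. Viguié, arXiv:1102.3031 / IJNT 8 (2012) (p = 2,3 variants); card J (`two-twin-half-squeeze-at-3`).
-/

set_option linter.dupNamespace false

open scoped Classical

open WeierstrassCurve NumberField IsDedekindDomain Field Literature.NumberTheory.EllipticCurves
  Rat.HeightOneSpectrum
  Literature.NumberTheory.DiophantineGeometry
  Literature.NumberTheory.EllipticCurves.GreenbergSelmer
  Literature.NumberTheory.EllipticCurves.ModularForms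
  Literature.NumberTheory.EllipticCurves.Rank1Residual
  Literature.NumberTheory.EllipticCurves.Rank1Residual.Typed
  Literature.NumberTheory.EllipticCurves.Wuthrich2014
  Literature.NumberTheory.EllipticCurves.BalakrishnanEtAl2019
  Literature.NumberTheory.QuadraticFields.Quadratic
  Literature.NumberTheory.Automorphic
  Literature.NumberTheory.GaloisRepresentations Literature.NumberTheory.GaloisCohomology
  Summit.BirchSwinnertonDyer.Rank1Residual.X11b.AcSelmer
  Summit.BirchSwinnertonDyer.Rank1Residual.X11b.LocBridge
  Summit.BirchSwinnertonDyer.Rank1Residual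
  Summit.BirchSwinnertonDyer.Rank1Residual.X11b
  Summit.BirchSwinnertonDyer.Rank1Residual.X11b.Three
  Summit.BirchSwinnertonDyer.BirchSwinnertonDyer.Theorems.CornerTwistWitness
  Summit.BirchSwinnertonDyer.BirchSwinnertonDyer.Theorems.CornerTwinHalves

namespace Summit.BirchSwinnertonDyer.BirchSwinnertonDyer.Cruxes.CornerAtThreeW.EllipticUnitReflex

/-! ## §1 The interface: a reflex-trivial twin gives F2′ by name -/

/-- **Kernel step.** If `Sel^{(3)}(E^d/ℚ) = 0` and `Ш(E^d/ℚ)` is finite then `3 ∤ #Ш(E^d/ℚ)`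
(the tree's `sha_torsionBy_eq_zero_of_selmerGroup_eq_bot` = AEC X.4.2(a), plus Cauchy's theorem). -/
theorem not_three_dvd_shaOrder_of_selmerGroup_eq_bot (Wd : WeierstrassCurve ℚ) [Wd.IsElliptic]
    (hfin : Finite Wd.sha) (hsel : Wd.selmerGroup 3 = ⊥) : ¬ 3 ∣ Wd.shaOrder := by
  intro h3
  haveI : Fact (Nat.Prime 3) := ⟨Nat.prime_three⟩
  haveI := hfin
  have hcard : 3 ∣ Nat.card Wd.sha := by simpa [WeierstrassCurve.shaOrder] using h3
  obtain ⟨x, hx⟩ := exists_prime_addOrderOf_dvd_card' (G := Wd.sha) 3 hcard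
  have hx0 : x = 0 :=
    Wd.sha_torsionBy_eq_zero_of_selmerGroup_eq_bot_nat (n := 3) (by norm_num)
      (by exact_mod_cast hsel) x (by rw [← hx]; exact addOrderOf_nsmul_eq_zero x)
  rw [hx0, addOrderOf_zero] at hx
  omega

/-- **R0 — `CornerReflexTrivialTwinAt W` (the OUTPUT of the reflex certificate, typed over the tree):** for the
corner curve `W` (`(E,3) ∈ X11b`, `ρ̄_{E,3}` not surjective) there is an odd Heegner twin frame `(K, Wd, Cd)`
(`IsTwinFrame`, card J) whose twin has TRIVIAL `3`-SELMER GROUP, finite `Ш`, and the Tamagawa–torsion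
inequality `ord₃ ∏c(E^d) − 2 ord₃ #tors(E^d) ≤ ord₃ L(E^d,1)/Ω(E^d)` (a modular-symbol value; at an EXACT twin
it is an equality). OPEN as a class-wide statement; a CERTIFICATE per pair. -/
def CornerReflexTrivialTwinAt (W : WeierstrassCurve ℚ) [W.IsElliptic] [W.IsGloballyMinimal] : Prop :=
  ClassX11b W 3 → ¬ Surj W 3 →
    ∃ (K : Type) (_ : Field K) (_ : NumberField K)
      (Wd : WeierstrassCurve ℚ) (_ : Wd.IsElliptic) (_ : Wd.IsGloballyMinimal) (Cd : VariableChange ℚ),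
      IsTwinFrame W K Wd Cd ∧ Wd.selmerGroup 3 = ⊥ ∧ Finite Wd.sha ∧
        ∃ q : ℚ, Wd.entireLFunction 1 / (Wd.realPeriodRat : ℂ) = (q : ℂ) ∧
          (padicValNat 3 Wd.tamagawaProduct : ℤ) - 2 * padicValNat 3 Wd.torsionOrder ≤ padicValRat 3 q

/-- **F2′ from a reflex-trivial twin, BY NAME** (`CornerTwinUpperAt W` of `ClassRecordThreeCornerTwinHalvesDefs`):
`twinUpper_of_sha_unit` fed with `not_three_dvd_shaOrder_of_selmerGroup_eq_bot`. Sorry-free. -/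
theorem cornerTwinUpperAt_of_reflexTrivialTwin (W : WeierstrassCurve ℚ) [W.IsElliptic] [W.IsGloballyMinimal]
    (h : CornerReflexTrivialTwinAt W) : CornerTwinUpperAt W := by
  intro hX hns
  obtain ⟨K, iF, iN, Wd, iE, iM, Cd, hfr, hsel, hfin, q, hq, hle⟩ := h hX hns
  exact ⟨K, iF, iN, Wd, iE, iM, Cd, hfr, q, hq,
    twinUpper_of_sha_unit Wd q (not_three_dvd_shaOrder_of_selmerGroup_eq_bot Wd hfin hsel) hle⟩

/-- **R0′ — `CornerSelmerTrivialTwinAt W`:** the same frame with `L(E^d,1) ≠ 0` made explicit for the twin's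
minimal model and NO finiteness clause (finiteness of `Ш(E^d)` then comes from Gross–Zagier–Kolyvagin at
analytic rank `0`). This is the statement a per-pair certificate decides: a twin frame, `Sel₃(Wd) = ⊥`, one value. -/
def CornerSelmerTrivialTwinAt (W : WeierstrassCurve ℚ) [W.IsElliptic] [W.IsGloballyMinimal] : Prop :=
  ClassX11b W 3 → ¬ Surj W 3 →
    ∃ (K : Type) (_ : Field K) (_ : NumberField K)
      (Wd : WeierstrassCurve ℚ) (_ : Wd.IsElliptic) (_ : Wd.IsGloballyMinimal) (Cd : VariableChange ℚ),
      IsTwinFrame W K Wd Cd ∧ Wd.selmerGroup 3 = ⊥ ∧ Wd.entireLFunction 1 ≠ 0 ∧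
        ∃ q : ℚ, Wd.entireLFunction 1 / (Wd.realPeriodRat : ℂ) = (q : ℂ) ∧
          (padicValNat 3 Wd.tamagawaProduct : ℤ) - 2 * padicValNat 3 Wd.torsionOrder ≤ padicValRat 3 q

/-- **Finiteness discharged by GZK.** Under the tree facts `hasEntireLFunction_rat` (BCDT) and
`rank_eq_analyticRank_of_analyticRank_le_one` (Gross–Zagier–Kolyvagin), `L(Wd,1) ≠ 0 ⟹ Ш(Wd)` finite, so
R0′ ⟹ R0. Sorry-free. -/
theorem reflexTrivialTwin_of_selmerTrivialTwin (hE : hasEntireLFunction_rat)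
    (hGZK : rank_eq_analyticRank_of_analyticRank_le_one)
    (W : WeierstrassCurve ℚ) [W.IsElliptic] [W.IsGloballyMinimal] (h : CornerSelmerTrivialTwinAt W) :
    CornerReflexTrivialTwinAt W := by
  intro hX hns
  obtain ⟨K, iF, iN, Wd, iE, iM, Cd, hfr, hsel, hL, q, hq, hle⟩ := h hX hns
  have h0 : Wd.analyticRank = 0 := (Wd.analyticRank_eq_zero_iff_holds (hE Wd)).mpr hL
  have hfin : Finite Wd.sha := (hGZK Wd (by rw [h0]; exact zero_le_one)).2
  exact ⟨K, iF, iN, Wd, iE, iM, Cd, hfr, hsel, hfin, q, hq, hle⟩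

/-- **F2′ from R0′ under BCDT + GZK, BY NAME.** -/
theorem cornerTwinUpperAt_of_selmerTrivialTwin (hE : hasEntireLFunction_rat)
    (hGZK : rank_eq_analyticRank_of_analyticRank_le_one)
    (W : WeierstrassCurve ℚ) [W.IsElliptic] [W.IsGloballyMinimal] (h : CornerSelmerTrivialTwinAt W) :
    CornerTwinUpperAt W :=
  cornerTwinUpperAt_of_reflexTrivialTwin W (reflexTrivialTwin_of_selmerTrivialTwin hE hGZK W h)

/-! ## §2 The descent is exact on the corner: Sah's lemma with the central `-I ∈ N(C)` -/

/-- **Exactness of the reflex on the corner.** If some `g₀ ∈ Γ_ℚ` acts as `-1` on `E^d[3]` and is central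
modulo `Γ_{ℚ(E^d[3])}` (on the corner: any `g₀` mapping to `-I ∈ N(C)`, which is central and lies in the image),
then `ker (H¹(ℚ, E^d[3]) → H¹(ℚ(E^d[3]), E^d[3])) = 0` — so `Sel₃(E^d/ℚ)` is read faithfully inside
`Hom(Γ_{ℚ(E^d[3])}, E^d[3])`, i.e. in Kummer theory of the `3`-division field. The tree's Sah lemma
`Rubin1987.subgroupResKer_eq_bot_of_bijOn` with `P ↦ g₀P − P = −2P = P`. Sorry-free. -/
theorem resKer_three_eq_bot_of_central_negOne (Wd : WeierstrassCurve ℚ) [Wd.IsElliptic]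
    {g₀ : absoluteGaloisGroup ℚ} (hneg : ∀ P : geomTorsion Wd 3, g₀ • P = -P)
    (hcomm : ∀ g : absoluteGaloisGroup ℚ, ∃ n ∈ torsionFixing Wd 3, g₀ * g = g * g₀ * n) :
    subgroupResKer (geomTorsion Wd 3) (torsionFixing Wd 3) = ⊥ := by
  have hs : {P : geomTorsion Wd 3 | ∀ m ∈ torsionFixing Wd 3, m • P = P} = Set.univ :=
    Set.eq_univ_of_forall fun P m hm ↦ smul_eq_of_mem_torsionFixing Wd 3 hm P
  refine Rubin1987.subgroupResKer_eq_bot_of_bijOn (torsionFixing Wd 3)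
    (isOpen_torsionFixing Wd (by norm_num)) hcomm ?_
  rw [hs]
  refine Set.bijOn_univ.2 ?_
  have hfun : (fun P : geomTorsion Wd 3 ↦ g₀ • P - P) = fun P ↦ P := by
    funext P
    have h3 : (3 : ℤ) • (P : geomPoints Wd) = 0 := (mem_geomTorsion_iff Wd 3 _).mp P.2
    have h3' : (3 : ℤ) • P = 0 := by
      apply Subtype.ext
      exact_mod_cast h3
    have e : -P - P = P - (3 : ℤ) • P := by abel
    rw [hneg, e, h3', sub_zero]
  rw [hfun]
  exact Function.bijective_id

/-! ## §3 The open supply of the line and the class-wide bookkeeping -/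

/-- OPEN (conjecture-grade class-wide; CERTIFICATE per pair) — **R3, `CornerEllipticUnitReflexSupplyAt W`:
the elliptic-unit reflex supply.** Typed at the OUTPUT level (it is literally R0′): an odd Heegner twin frame with
`Sel₃(Wd) = ⊥` and the Tamagawa–torsion inequality. Its intended PROOF ∕ CERTIFICATE is the reflex chain
(R1) + (R2) of the card, not typable in the tree today (no Galois action on `ClassGroup`):
(R1) REFLEX CRITERION — with `G_d = Gal(L_d/ℚ) ≅ N(C)` (`3 ∤ #G_d`, `§2`), `V = E^d[3]`:
  `dim Sel₃(E^d) ≤ m_V(Cl(L_d)[3]) + dim( U_V ∩ loc₃⁻¹(H¹(ℚ₃, μ₃-line)) )`, `U_V` = the `V`-part of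
  `𝓞_{L_d}[1/3]^× ⊗ 𝔽₃` (two classes when `Cl^V = 0`: the unit `u_d` and one `3`-unit `s_d`) — the frame makes the
  carriers inert (Tamagawa numbers of `E^d` prime to `3` away from `3`) and `q_{E,3}` is a cube (local condition at `3`
  = the `μ₃`-line), so no other place contributes (Schaefer–Stoll ∕ Česnavičius §3 bookkeeping);
(R2) RUBIN — `L_d/M` abelian, `3 ∤ w_M [L_d:M]`: `#Cl(L_d)[3^∞]^χ ∣ #(𝓞^×_{L_d}/𝓒_{L_d})[3^∞]^χ` for the
  character(s) `χ` of `Gal(L_d/M)` carrying `V` (3Ns: `χ` quadratic, `m_V = rk₃ Cl(ℚ(P_d)) − rk₃ Cl(M)` for the quartic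
  field of a `3`-torsion point `P_d` with `M ⊂ ℚ(P_d)`; 3Nn: `χ` of order `8`, relative class group of `L_d/L_d^+`);
so `Sel₃(E^d) = 0` ⟸ [`u_d` is `3`-primitive in the `χ`-units] ∧ [`u_d, s_d, u_d s_d^{±1}` fail the `μ₃`-line test at `3`].
WHY IT MIGHT FAIL: the class-wide `∃ d` is a horizontal non-vanishing-mod-`3` statement for elliptic units ∕ Katz values
in a THIN (rational-`d`) family — open; Rubin's theorem at `p = 3` with `3` RAMIFIED in `M` (3Ns-a, 3Nn: 167 pairs)
must be re-read from Invent. 103 (text wanted). [cite: Rubin 1991, Invent. Math. 103, §§1–4]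
[cite: arXiv:1307.4261, §3] -/
@[conjecture]
def CornerEllipticUnitReflexSupplyAt (W : WeierstrassCurve ℚ) [W.IsElliptic] [W.IsGloballyMinimal] : Prop :=
  CornerSelmerTrivialTwinAt W

/-- Class-wide form (the statement that would replace the class-wide F2′ `CornerTwinUpper` on the reflex line). -/
@[conjecture]
def CornerEllipticUnitReflexSupply : Prop :=
  ∀ (W : WeierstrassCurve ℚ) [W.IsElliptic] [W.IsGloballyMinimal], CornerEllipticUnitReflexSupplyAt W

/-- **Bookkeeping, BY NAME:** the reflex supply gives the class-wide F2′ `CornerTwinUpper` under BCDT + GZK. -/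
theorem cornerTwinUpper_of_supply (hE : hasEntireLFunction_rat)
    (hGZK : rank_eq_analyticRank_of_analyticRank_le_one) (h : CornerEllipticUnitReflexSupply) :
    CornerTwinUpper := by
  intro W _ _
  exact cornerTwinUpperAt_of_selmerTrivialTwin hE hGZK W (h W)

end Summit.BirchSwinnertonDyer.BirchSwinnertonDyer.Cruxes.CornerAtThreeW.EllipticUnitReflex
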